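import Summits.CriticalPhenomena.PercolationContinuityZ3.Theorems.PercNearOneGluingNoHeavyLowerTailFrontierDecRowsTerminalEdgeInduction
import Summits.CriticalPhenomena.PercolationContinuityZ3.Theorems.PercNearOneGluingNoHeavyLowerTailFrontierDecRowsLeFive
import Literature.Probability.Percolation.KozmaNitzanSeparatingTriple
import HarnessLib

/-!
# The terminal-edge step of the 45 four-point decreasing frontier rows: reduction of every row, for ALL `n`, to its terminal-edge
# hypotheses, and the hypotheses as cubic forms in ONE law (lifting along the stepped edge)

Support file (prover seat `prim-bnk-1`, gen 8; `--supports stmt-CriticalPhenomena-4575`).  No named facts, no sorries, no `native_decide`; one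
bookkeeping definition `liftPred`.  Companion of `…FrontierDecRowsTerminalEdgeInduction` (the schema `TerminalEdgeInduction.sahiE3_nonneg_of_terminalEdgeHyp`).

* `frontier_all_of_terminalEdgeHyp (i : Fin 45)`: for the representative triple `FrontierDecRows.row i` (table in `…FrontierDecRowsLeFive`),
  `TerminalEdgeHyp` of its three events (as families of the marking `(a,b,c,y) = (x 0, x 1, x 2, x 3)`; local by `isLocal_row`) implies
  `0 ≤ E₃(D₁,D₂,D₃)` under `prodBernoulli w` for every `n`, every `w` and all pairwise distinct `a b c y` — the standing reduction of the seven
  open rows `12, 15, 27, 30, 36 (PATH), 37, 44` to polarised forms at the edge types `(terminal, other terminal)` (four-point laws; certified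
  exactly at degree 3 for rows 36 and 44, prim-l12-p1 kit j094120/j094121) and `(terminal, unmarked vertex)` (five-point laws; open).
* ONE LAW.  For the step at `e = s(t,u)`, `μ¹ = prodBernoulli w[e↦1]` is the image of `μ⁰ = prodBernoulli w[e↦0]` under `ω ↦ insert e ω`
  (`real_update_one_eq_real_update_zero_insert`, from the tree's `goodStepEI_prodBernoulli_map_insert`), and on connectivity events `insert e`
  acts as the LIFT `liftPred t u` (`insert_mem_connEvent_iff`, from `KNSep.reachable_insert_iff`: `a ~ b` becomes
  `a ~ b ∨ (a ~ t ∧ u ~ b) ∨ (a ~ u ∧ t ~ b)`): `μ¹(connEvent P) = μ⁰(connEvent (liftPred t u P))` (`real_update_one_connEvent`).  Hence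
  `polar₁ μ⁰ μ¹` and `polar₁ μ¹ μ⁰` of three connectivity events are explicit cubic forms in `μ⁰`-probabilities of the predicates, their
  conjunctions and their lifts (`polar₁_zero_one_connEvent`, `polar₁_one_zero_connEvent`).  For a four-terminal row and `t` a terminal, `u`
  unmarked, all these predicates are pattern predicates of the FIVE points `(a,b,c,y,u)`: each terminal-edge hypothesis is a cubic inequality in
  the 52-cell five-point pattern law under `w[e↦0]` (plus the induction-hypothesis rows `E₃ ≥ 0` under `w[e↦0]`, `w[e↦1]`), i.e. exactly the
  object prim-l12-p1's polar5.py generates and a kernel certificate would close.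
-/

noncomputable section

namespace Summit.CriticalPhenomena.PercolationContinuityZ3.Theorems

namespace TerminalEdgeInduction

open MeasureTheory Literature.Probability.Percolation Literature.Probability.LatticeModels
open EdgeInduction CovTransferCert E3GroupSepCert
open scoped Classical

variable {n k : ℕ}

/-! ### Lifting along the stepped edge: both laws of a step as ONE law

For the step at `e = s(t, u)` the two laws are `μ⁰ = prodBernoulli w[e ↦ 0]` and `μ¹ = prodBernoulli w[e ↦ 1]`, and `μ¹` is the image of
`μ⁰` under `ω ↦ insert e ω` (tree: `goodStepEI_prodBernoulli_map_insert`).  On connectivity events this is the LIFT `liftPred t u`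
(`KNSep.reachable_insert_iff`): so every term of `polar₁ μ⁰ μ¹` / `polar₁ μ¹ μ⁰` is a `μ⁰`-probability of a connectivity predicate, and
for pattern predicates of `k` terminals with `t` a terminal the lifted predicates are pattern predicates of the `k + 1` points
`(terminals, u)` — the terminal-edge hypotheses are cubic inequalities in ONE `(k+1)`-point pattern law. -/

/-- The lift of a connectivity predicate along the pair `s(t, u)`: `P` read on the connectivity relation of `insert s(t,u) ω`, i.e. with
`a ~ b` replaced by `a ~ b ∨ (a ~ t ∧ u ~ b) ∨ (a ~ u ∧ t ~ b)`. [this work] -/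
def liftPred (t u : Fin n) (P : CRel n → Bool) : CRel n → Bool :=
  fun r => P (fun a b => r a b || (r a t && r u b) || (r a u && r t b))

/-- Adding the edge `s(t,u)` to a configuration acts on connectivity events as `liftPred t u`. [this work] -/
theorem insert_mem_connEvent_iff (t u : Fin n) (P : CRel n → Bool) (ω : BondConfig (Fin n)) :
    insert s(t, u) ω ∈ connEvent P ↔ ω ∈ connEvent (liftPred t u P) := by
  have hf : (fun a b => decide (insert s(t, u) ω ∈ openConn a b)) =
      fun a b => (decide (ω ∈ openConn a b) || (decide (ω ∈ openConn a t) && decide (ω ∈ openConn u b)) ||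
        (decide (ω ∈ openConn a u) && decide (ω ∈ openConn t b))) := by
    funext a b
    have h := KNSep.reachable_insert_iff ω t u a b
    simp only [openConn, Set.mem_setOf_eq]
    rw [Bool.eq_iff_iff]
    simp only [decide_eq_true_eq, Bool.or_eq_true, Bool.and_eq_true]
    rw [h, or_assoc]
  simp only [connEvent, Set.mem_setOf_eq, liftPred]
  rw [hf]

/-- **`μ_{w[e↦1]}` is the image of `μ_{w[e↦0]}` under `insert e`**, on every event. [folklore] -/
theorem real_update_one_eq_real_update_zero_insert (w : Sym2 (Fin n) → unitInterval) (e : Sym2 (Fin n))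
    (S : Set (BondConfig (Fin n))) :
    (prodBernoulli (Function.update w e 1)).real S =
      (prodBernoulli (Function.update w e 0)).real {ω | insert e ω ∈ S} := by
  have hmi : Measurable fun ω : BondConfig (Fin n) => insert e ω := fun s _ => (Set.toFinite _).measurableSet
  rw [show Function.update w e 1 = Function.update (Function.update w e 0) e 1 from (Function.update_idem _ _ _).symm,
    ← goodStepEI_prodBernoulli_map_insert (Function.update w e 0) e, measureReal_def, measureReal_def,
    Measure.map_apply hmi (Set.toFinite S).measurableSet]
  rfl

/-- **Connectivity events under `w[s(t,u) ↦ 1]` are lifted connectivity events under `w[s(t,u) ↦ 0]`.** [this work] -/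
theorem real_update_one_connEvent (w : Sym2 (Fin n) → unitInterval) (t u : Fin n) (P : CRel n → Bool) :
    (prodBernoulli (Function.update w s(t, u) 1)).real (connEvent P) =
      (prodBernoulli (Function.update w s(t, u) 0)).real (connEvent (liftPred t u P)) := by
  rw [real_update_one_eq_real_update_zero_insert]
  congr 1
  ext ω
  exact insert_mem_connEvent_iff t u P ω

/-- **The first polarised coefficient of a step, under ONE law**: `polar₁ μ⁰ μ¹` of three connectivity events as a cubic form in
`μ⁰`-probabilities of the predicates, their conjunctions (`pAnd`) and their lifts (`liftPred t u`). [this work] -/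
theorem polar₁_zero_one_connEvent (w : Sym2 (Fin n) → unitInterval) (t u : Fin n) (P₁ P₂ P₃ : CRel n → Bool) :
    polar₁ (prodBernoulli (Function.update w s(t, u) 0)) (prodBernoulli (Function.update w s(t, u) 1))
        (connEvent P₁) (connEvent P₂) (connEvent P₃) =
      (1 / 3 : ℝ) *
        (2 * (prodBernoulli (Function.update w s(t, u) 0)).real (connEvent (liftPred t u (pAnd (pAnd P₁ P₂) P₃)))
          + 4 * (prodBernoulli (Function.update w s(t, u) 0)).real (connEvent (pAnd (pAnd P₁ P₂) P₃))
          + ((prodBernoulli (Function.update w s(t, u) 0)).real (connEvent (liftPred t u P₁))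
                * (prodBernoulli (Function.update w s(t, u) 0)).real (connEvent P₂)
                * (prodBernoulli (Function.update w s(t, u) 0)).real (connEvent P₃)
              + (prodBernoulli (Function.update w s(t, u) 0)).real (connEvent P₁)
                * (prodBernoulli (Function.update w s(t, u) 0)).real (connEvent (liftPred t u P₂))
                * (prodBernoulli (Function.update w s(t, u) 0)).real (connEvent P₃)
              + (prodBernoulli (Function.update w s(t, u) 0)).real (connEvent P₁)
                * (prodBernoulli (Function.update w s(t, u) 0)).real (connEvent P₂)
                * (prodBernoulli (Function.update w s(t, u) 0)).real (connEvent (liftPred t u P₃)))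
          - ((prodBernoulli (Function.update w s(t, u) 0)).real (connEvent P₁)
                * (prodBernoulli (Function.update w s(t, u) 0)).real (connEvent (pAnd P₂ P₃))
              + (prodBernoulli (Function.update w s(t, u) 0)).real (connEvent P₂)
                * (prodBernoulli (Function.update w s(t, u) 0)).real (connEvent (pAnd P₁ P₃))
              + (prodBernoulli (Function.update w s(t, u) 0)).real (connEvent P₃)
                * (prodBernoulli (Function.update w s(t, u) 0)).real (connEvent (pAnd P₁ P₂)))
          - ((prodBernoulli (Function.update w s(t, u) 0)).real (connEvent (liftPred t u P₁))
                * (prodBernoulli (Function.update w s(t, u) 0)).real (connEvent (pAnd P₂ P₃))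
              + (prodBernoulli (Function.update w s(t, u) 0)).real (connEvent P₁)
                * (prodBernoulli (Function.update w s(t, u) 0)).real (connEvent (liftPred t u (pAnd P₂ P₃)))
              + (prodBernoulli (Function.update w s(t, u) 0)).real (connEvent (liftPred t u P₂))
                * (prodBernoulli (Function.update w s(t, u) 0)).real (connEvent (pAnd P₁ P₃))
              + (prodBernoulli (Function.update w s(t, u) 0)).real (connEvent P₂)
                * (prodBernoulli (Function.update w s(t, u) 0)).real (connEvent (liftPred t u (pAnd P₁ P₃)))
              + (prodBernoulli (Function.update w s(t, u) 0)).real (connEvent (liftPred t u P₃))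
                * (prodBernoulli (Function.update w s(t, u) 0)).real (connEvent (pAnd P₁ P₂))
              + (prodBernoulli (Function.update w s(t, u) 0)).real (connEvent P₃)
                * (prodBernoulli (Function.update w s(t, u) 0)).real (connEvent (liftPred t u (pAnd P₁ P₂))))) := by
  simp only [polar₁, ← connEvent_pAnd, real_update_one_connEvent]

/-- **The second polarised coefficient of a step, under ONE law**: `polar₁ μ¹ μ⁰` likewise. [this work] -/
theorem polar₁_one_zero_connEvent (w : Sym2 (Fin n) → unitInterval) (t u : Fin n) (P₁ P₂ P₃ : CRel n → Bool) :
    polar₁ (prodBernoulli (Function.update w s(t, u) 1)) (prodBernoulli (Function.update w s(t, u) 0))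
        (connEvent P₁) (connEvent P₂) (connEvent P₃) =
      (1 / 3 : ℝ) *
        (2 * (prodBernoulli (Function.update w s(t, u) 0)).real (connEvent (pAnd (pAnd P₁ P₂) P₃))
          + 4 * (prodBernoulli (Function.update w s(t, u) 0)).real (connEvent (liftPred t u (pAnd (pAnd P₁ P₂) P₃)))
          + ((prodBernoulli (Function.update w s(t, u) 0)).real (connEvent P₁)
                * (prodBernoulli (Function.update w s(t, u) 0)).real (connEvent (liftPred t u P₂))
                * (prodBernoulli (Function.update w s(t, u) 0)).real (connEvent (liftPred t u P₃))
              + (prodBernoulli (Function.update w s(t, u) 0)).real (connEvent (liftPred t u P₁))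
                * (prodBernoulli (Function.update w s(t, u) 0)).real (connEvent P₂)
                * (prodBernoulli (Function.update w s(t, u) 0)).real (connEvent (liftPred t u P₃))
              + (prodBernoulli (Function.update w s(t, u) 0)).real (connEvent (liftPred t u P₁))
                * (prodBernoulli (Function.update w s(t, u) 0)).real (connEvent (liftPred t u P₂))
                * (prodBernoulli (Function.update w s(t, u) 0)).real (connEvent P₃))
          - ((prodBernoulli (Function.update w s(t, u) 0)).real (connEvent (liftPred t u P₁))
                * (prodBernoulli (Function.update w s(t, u) 0)).real (connEvent (liftPred t u (pAnd P₂ P₃)))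
              + (prodBernoulli (Function.update w s(t, u) 0)).real (connEvent (liftPred t u P₂))
                * (prodBernoulli (Function.update w s(t, u) 0)).real (connEvent (liftPred t u (pAnd P₁ P₃)))
              + (prodBernoulli (Function.update w s(t, u) 0)).real (connEvent (liftPred t u P₃))
                * (prodBernoulli (Function.update w s(t, u) 0)).real (connEvent (liftPred t u (pAnd P₁ P₂))))
          - ((prodBernoulli (Function.update w s(t, u) 0)).real (connEvent P₁)
                * (prodBernoulli (Function.update w s(t, u) 0)).real (connEvent (liftPred t u (pAnd P₂ P₃)))
              + (prodBernoulli (Function.update w s(t, u) 0)).real (connEvent (liftPred t u P₁))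
                * (prodBernoulli (Function.update w s(t, u) 0)).real (connEvent (pAnd P₂ P₃))
              + (prodBernoulli (Function.update w s(t, u) 0)).real (connEvent P₂)
                * (prodBernoulli (Function.update w s(t, u) 0)).real (connEvent (liftPred t u (pAnd P₁ P₃)))
              + (prodBernoulli (Function.update w s(t, u) 0)).real (connEvent (liftPred t u P₂))
                * (prodBernoulli (Function.update w s(t, u) 0)).real (connEvent (pAnd P₁ P₃))
              + (prodBernoulli (Function.update w s(t, u) 0)).real (connEvent P₃)
                * (prodBernoulli (Function.update w s(t, u) 0)).real (connEvent (liftPred t u (pAnd P₁ P₂)))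
              + (prodBernoulli (Function.update w s(t, u) 0)).real (connEvent (liftPred t u P₃))
                * (prodBernoulli (Function.update w s(t, u) 0)).real (connEvent (pAnd P₁ P₂)))) := by
  simp only [polar₁, ← connEvent_pAnd, real_update_one_connEvent]

/-! ### The 45 essential four-point decreasing frontier rows (`FrontierDecRows.row`, marking `(a, b, c, y) = (x 0, x 1, x 2, x 3)`) -/

/-- The three events of every frontier row are local families of the marking `(a,b,c,y) = (x 0, x 1, x 2, x 3)` (each is a group separation
`D[X|Y]` with `X, Y` sub-lists of the terminals). [this work] -/
theorem isLocal_row (i : Fin 45) :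
    IsLocal (fun x : Fin 4 → Fin n => connEvent (FrontierDecRows.row i n (x 0, x 1, x 2, x 3)).1) ∧
      IsLocal (fun x : Fin 4 → Fin n => connEvent (FrontierDecRows.row i n (x 0, x 1, x 2, x 3)).2.1) ∧
      IsLocal (fun x : Fin 4 → Fin n => connEvent (FrontierDecRows.row i n (x 0, x 1, x 2, x 3)).2.2) := by
  fin_cases i
  · exact ⟨(isLocal_sep [0, 1, 2] [3]).of_eq fun x => rfl, (isLocal_sep [0, 1, 3] [2]).of_eq fun x => rfl,
      (isLocal_sep [0, 2] [1]).of_eq fun x => rfl⟩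
  · exact ⟨(isLocal_sep [0, 1, 2] [3]).of_eq fun x => rfl, (isLocal_sep [0, 1] [2]).of_eq fun x => rfl,
      (isLocal_sep [0, 2] [1, 3]).of_eq fun x => rfl⟩
  · exact ⟨(isLocal_sep [0, 1, 2] [3]).of_eq fun x => rfl, (isLocal_sep [0, 1] [2]).of_eq fun x => rfl,
      (isLocal_sep [0, 3] [1]).of_eq fun x => rfl⟩
  · exact ⟨(isLocal_sep [0, 1, 2] [3]).of_eq fun x => rfl, (isLocal_sep [0, 1] [2, 3]).of_eq fun x => rfl,
      (isLocal_sep [0, 3] [1]).of_eq fun x => rfl⟩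
  · exact ⟨(isLocal_sep [0, 1, 2] [3]).of_eq fun x => rfl, (isLocal_sep [0, 3] [1]).of_eq fun x => rfl,
      (isLocal_sep [0] [2]).of_eq fun x => rfl⟩
  · exact ⟨(isLocal_sep [0, 1, 2] [3]).of_eq fun x => rfl, (isLocal_sep [0, 3] [1]).of_eq fun x => rfl,
      (isLocal_sep [0] [2, 3]).of_eq fun x => rfl⟩
  · exact ⟨(isLocal_sep [0, 1, 2] [3]).of_eq fun x => rfl, (isLocal_sep [0, 3] [1]).of_eq fun x => rfl,
      (isLocal_sep [1] [2]).of_eq fun x => rfl⟩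
  · exact ⟨(isLocal_sep [0, 1] [2]).of_eq fun x => rfl, (isLocal_sep [0, 1] [3]).of_eq fun x => rfl,
      (isLocal_sep [0, 2] [1]).of_eq fun x => rfl⟩
  · exact ⟨(isLocal_sep [0, 1] [2]).of_eq fun x => rfl, (isLocal_sep [0, 1] [3]).of_eq fun x => rfl,
      (isLocal_sep [0, 2] [3]).of_eq fun x => rfl⟩
  · exact ⟨(isLocal_sep [0, 1] [2]).of_eq fun x => rfl, (isLocal_sep [0, 2] [1]).of_eq fun x => rfl,
      (isLocal_sep [1, 3] [2]).of_eq fun x => rfl⟩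
  · exact ⟨(isLocal_sep [0, 1] [2]).of_eq fun x => rfl, (isLocal_sep [0, 2] [1]).of_eq fun x => rfl,
      (isLocal_sep [1] [3]).of_eq fun x => rfl⟩
  · exact ⟨(isLocal_sep [0, 1] [2]).of_eq fun x => rfl, (isLocal_sep [0, 2] [1, 3]).of_eq fun x => rfl,
      (isLocal_sep [0, 3] [1]).of_eq fun x => rfl⟩
  · exact ⟨(isLocal_sep [0, 1] [2]).of_eq fun x => rfl, (isLocal_sep [0, 2] [1, 3]).of_eq fun x => rfl,
      (isLocal_sep [1] [3]).of_eq fun x => rfl⟩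
  · exact ⟨(isLocal_sep [0, 1] [2]).of_eq fun x => rfl, (isLocal_sep [0, 2] [3]).of_eq fun x => rfl,
      (isLocal_sep [0] [1]).of_eq fun x => rfl⟩
  · exact ⟨(isLocal_sep [0, 1] [2]).of_eq fun x => rfl, (isLocal_sep [0, 2] [3]).of_eq fun x => rfl,
      (isLocal_sep [0] [1, 3]).of_eq fun x => rfl⟩
  · exact ⟨(isLocal_sep [0, 1] [2]).of_eq fun x => rfl, (isLocal_sep [0, 2] [3]).of_eq fun x => rfl,
      (isLocal_sep [1] [3]).of_eq fun x => rfl⟩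
  · exact ⟨(isLocal_sep [0, 1] [2]).of_eq fun x => rfl, (isLocal_sep [0, 3] [2]).of_eq fun x => rfl,
      (isLocal_sep [0] [1]).of_eq fun x => rfl⟩
  · exact ⟨(isLocal_sep [0, 1] [2]).of_eq fun x => rfl, (isLocal_sep [0] [1]).of_eq fun x => rfl,
      (isLocal_sep [0] [2, 3]).of_eq fun x => rfl⟩
  · exact ⟨(isLocal_sep [0, 1] [2]).of_eq fun x => rfl, (isLocal_sep [0] [1]).of_eq fun x => rfl,
      (isLocal_sep [0] [3]).of_eq fun x => rfl⟩
  · exact ⟨(isLocal_sep [0, 1] [2]).of_eq fun x => rfl, (isLocal_sep [0] [3]).of_eq fun x => rfl,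
      (isLocal_sep [2] [3]).of_eq fun x => rfl⟩
  · exact ⟨(isLocal_sep [0, 1, 2] [3]).of_eq fun x => rfl, (isLocal_sep [0, 1, 3] [2]).of_eq fun x => rfl,
      (isLocal_sep [0, 2] [1, 3]).of_eq fun x => rfl⟩
  · exact ⟨(isLocal_sep [0, 1, 2] [3]).of_eq fun x => rfl, (isLocal_sep [0, 1] [2]).of_eq fun x => rfl,
      (isLocal_sep [0, 2] [1]).of_eq fun x => rfl⟩
  · exact ⟨(isLocal_sep [0, 1, 2] [3]).of_eq fun x => rfl, (isLocal_sep [0, 1] [2]).of_eq fun x => rfl,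
      (isLocal_sep [0] [1]).of_eq fun x => rfl⟩
  · exact ⟨(isLocal_sep [0, 1, 2] [3]).of_eq fun x => rfl, (isLocal_sep [0, 1] [2, 3]).of_eq fun x => rfl,
      (isLocal_sep [0] [1]).of_eq fun x => rfl⟩
  · exact ⟨(isLocal_sep [0, 1, 2] [3]).of_eq fun x => rfl, (isLocal_sep [0, 3] [1]).of_eq fun x => rfl,
      (isLocal_sep [0, 3] [2]).of_eq fun x => rfl⟩
  · exact ⟨(isLocal_sep [0, 1, 2] [3]).of_eq fun x => rfl, (isLocal_sep [0, 3] [1]).of_eq fun x => rfl,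
      (isLocal_sep [1] [2, 3]).of_eq fun x => rfl⟩
  · exact ⟨(isLocal_sep [0, 1, 2] [3]).of_eq fun x => rfl, (isLocal_sep [0] [1]).of_eq fun x => rfl,
      (isLocal_sep [0] [2]).of_eq fun x => rfl⟩
  · exact ⟨(isLocal_sep [0, 1] [2]).of_eq fun x => rfl, (isLocal_sep [0, 1] [3]).of_eq fun x => rfl,
      (isLocal_sep [0, 2] [1, 3]).of_eq fun x => rfl⟩
  · exact ⟨(isLocal_sep [0, 1] [2]).of_eq fun x => rfl, (isLocal_sep [0, 2] [1]).of_eq fun x => rfl,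
      (isLocal_sep [0] [3]).of_eq fun x => rfl⟩
  · exact ⟨(isLocal_sep [0, 1] [2]).of_eq fun x => rfl, (isLocal_sep [0, 2] [1]).of_eq fun x => rfl,
      (isLocal_sep [1, 2] [3]).of_eq fun x => rfl⟩
  · exact ⟨(isLocal_sep [0, 1] [2]).of_eq fun x => rfl, (isLocal_sep [0, 2] [1, 3]).of_eq fun x => rfl,
      (isLocal_sep [1] [2, 3]).of_eq fun x => rfl⟩
  · exact ⟨(isLocal_sep [0, 1] [2]).of_eq fun x => rfl, (isLocal_sep [0, 2] [3]).of_eq fun x => rfl,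
      (isLocal_sep [1, 2] [3]).of_eq fun x => rfl⟩
  · exact ⟨(isLocal_sep [0, 1] [2]).of_eq fun x => rfl, (isLocal_sep [0, 3] [2]).of_eq fun x => rfl,
      (isLocal_sep [1] [3]).of_eq fun x => rfl⟩
  · exact ⟨(isLocal_sep [0, 1] [2]).of_eq fun x => rfl, (isLocal_sep [0] [1]).of_eq fun x => rfl,
      (isLocal_sep [2] [3]).of_eq fun x => rfl⟩
  · exact ⟨(isLocal_sep [0, 1] [2]).of_eq fun x => rfl, (isLocal_sep [0] [2, 3]).of_eq fun x => rfl,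
      (isLocal_sep [1] [3]).of_eq fun x => rfl⟩
  · exact ⟨(isLocal_sep [0, 1] [2]).of_eq fun x => rfl, (isLocal_sep [0] [3]).of_eq fun x => rfl,
      (isLocal_sep [1] [3]).of_eq fun x => rfl⟩
  · exact ⟨(isLocal_sep [0] [1]).of_eq fun x => rfl, (isLocal_sep [0] [2]).of_eq fun x => rfl,
      (isLocal_sep [1] [3]).of_eq fun x => rfl⟩
  · exact ⟨(isLocal_sep [0, 1] [2]).of_eq fun x => rfl, (isLocal_sep [0, 2] [3]).of_eq fun x => rfl,
      (isLocal_sep [0, 3] [1]).of_eq fun x => rfl⟩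
  · exact ⟨(isLocal_sep [0, 1, 2] [3]).of_eq fun x => rfl, (isLocal_sep [0, 1, 3] [2]).of_eq fun x => rfl,
      (isLocal_sep [0] [1]).of_eq fun x => rfl⟩
  · exact ⟨(isLocal_sep [0, 1] [2]).of_eq fun x => rfl, (isLocal_sep [0, 1] [3]).of_eq fun x => rfl,
      (isLocal_sep [0] [1]).of_eq fun x => rfl⟩
  · exact ⟨(isLocal_sep [0, 1] [2]).of_eq fun x => rfl, (isLocal_sep [0, 1] [3]).of_eq fun x => rfl,
      (isLocal_sep [2] [3]).of_eq fun x => rfl⟩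
  · exact ⟨(isLocal_sep [0, 1, 2] [3]).of_eq fun x => rfl, (isLocal_sep [0, 1, 3] [2]).of_eq fun x => rfl,
      (isLocal_sep [0, 2, 3] [1]).of_eq fun x => rfl⟩
  · exact ⟨(isLocal_sep [0] [1]).of_eq fun x => rfl, (isLocal_sep [0] [2]).of_eq fun x => rfl,
      (isLocal_sep [0] [3]).of_eq fun x => rfl⟩
  · exact ⟨(isLocal_sep [0] [1]).of_eq fun x => rfl, (isLocal_sep [0] [2]).of_eq fun x => rfl,
      (isLocal_sep [1] [2]).of_eq fun x => rfl⟩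
  · exact ⟨(isLocal_sep [0, 1] [2, 3]).of_eq fun x => rfl, (isLocal_sep [0] [1]).of_eq fun x => rfl,
      (isLocal_sep [2] [3]).of_eq fun x => rfl⟩

/-- Four pairwise distinct vertices form an injective marking `![a, b, c, y]`. [folklore] -/
theorem injective_vec4 {a b c y : Fin n} (hab : a ≠ b) (hac : a ≠ c) (hay : a ≠ y) (hbc : b ≠ c) (hby : b ≠ y)
    (hcy : c ≠ y) : Function.Injective ![a, b, c, y] := by
  intro i j h
  fin_cases i <;> fin_cases j <;> simp at h ⊢
  all_goals first
    | exact hab h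
    | exact hac h
    | exact hay h
    | exact hbc h
    | exact hby h
    | exact hcy h
    | exact hab h.symm
    | exact hac h.symm
    | exact hay h.symm
    | exact hbc h.symm
    | exact hby h.symm
    | exact hcy h.symm

/-- **Every frontier row, for ALL `n`, from its terminal-edge hypotheses.**  If the polarised Bernstein coefficients of row `i` are
nonnegative at every terminal-incident edge (given the induction hypotheses; `TerminalEdgeHyp`), then
`0 ≤ E₃(D₁, D₂, D₃)` for the representative triple `row i` at every pairwise distinct `a b c y` of every finite weighted graph.
(For the seven open rows `12, 15, 27, 30, 36 (PATH), 37, 44` this is the standing reduction of the all-`n` statement to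
five-point polarised forms; the terminal–terminal forms of rows 36 and 44 are certified, prim-l12-p1 gen 3.) [this work] -/
theorem frontier_all_of_terminalEdgeHyp (i : Fin 45)
    (h : TerminalEdgeHyp (fun x : Fin 4 → Fin n => connEvent (FrontierDecRows.row i n (x 0, x 1, x 2, x 3)).1)
      (fun x => connEvent (FrontierDecRows.row i n (x 0, x 1, x 2, x 3)).2.1)
      (fun x => connEvent (FrontierDecRows.row i n (x 0, x 1, x 2, x 3)).2.2))
    (w : Sym2 (Fin n) → unitInterval) (a b c y : Fin n) (hab : a ≠ b) (hac : a ≠ c) (hay : a ≠ y) (hbc : b ≠ c)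
    (hby : b ≠ y) (hcy : c ≠ y) :
    0 ≤ sahiE3 (prodBernoulli w) (connEvent (FrontierDecRows.row i n (a, b, c, y)).1)
      (connEvent (FrontierDecRows.row i n (a, b, c, y)).2.1) (connEvent (FrontierDecRows.row i n (a, b, c, y)).2.2) :=
  sahiE3_nonneg_of_terminalEdgeHyp (isLocal_row i).1 (isLocal_row i).2.1 (isLocal_row i).2.2 h w ![a, b, c, y]
    (injective_vec4 hab hac hay hbc hby hcy)

end TerminalEdgeInduction

end Summit.CriticalPhenomena.PercolationContinuityZ3.Theorems
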